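import Mathlib.Topology.MetricSpace.ProperSpace
import Literature.Geometry.Lorentzian.Basic
import Literature.Geometry.Lorentzian.CoordScalarCurvatureEvolution
import Summits.FinalStateConjecture.FinalStateConjecture.Theorems.BartnikGapSettlingGapExhaustionFinslerLemma
import Summits.FinalStateConjecture.FinalStateConjecture.Theorems.BartnikGapSettlingGapExhaustionConditionalMarginMultiplier
import HarnessLib

/-!
# Crux `GapExhaustion` (stmt-FinalStateConjecture-10808), line `photon-shell-pseudoconvexity`:
# stub (P-1) `stub_multiplierFormStable` — the uniform, `C¹`-stable multiplier form of a
# constrained Hessian margin (Ionescu–Klainerman, Invent. Math. 175 (2009), Def. 3.1, (po3))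

Route `BartnikGapSettling`; helper (`--supports stmt-FinalStateConjecture-10808`) landing the
registered sub-stub (P-1) of line lead c8. The geometry (§1c of the line, (T-B)/(T-C)/(T-E))
gives a MARGIN `Hess f(w,w) ≤ −m‖w‖²` on the constrained cone
`{G₀ x w w = 0, df_x(w) = 0, G₀ x e w = 0}` at every point `x` of a compact set `S`; the
Carleman estimate of Ionescu–Klainerman (Invent. Math. 175 (2009), Prop. 3.3) consumes instead the
QUANTITATIVE condition (po3) of their Definition 3.1: ONE constant `ε₁ > 0` and, at each point,
a multiplier `μ ∈ [−ε₁⁻¹, ε₁⁻¹]` with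
`ε₁²|X|² ≤ X X(μ g − D²f) + ε₁⁻²(|g(T,X)|² + |df(X)|²)` for ALL vectors `X`.
This file proves that the former implies the latter UNIFORMLY on `S` and STABLY under a
`δ`-perturbation of the `1`-jet `(G x, DG(x))` of the components at the point and of the
conditioning vector `e ↦ e'` (`T`), which is the form a perturbative (near-Kerr) sweep needs.

Proof. Pointwise, Finsler's lemma with margin (F-1, `stub_finslerLemma`, p127090) and its doubly
constrained form (F-2, `stub_conditionalMarginMultiplier`, p127029) give `μ, C ≥ 0, c > 0` with
`Hess − μ G₀ − C·pen ≤ −c‖w‖²` for all `w` at `x` (`pen = df(w)² + (G₀ x e w)²`). With THESE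
constants frozen, the jet functional `(x', p, v) ↦ Hess' − μ G' − C pen'` is continuous, so by
compactness of the unit sphere it stays `< −c/2` on all unit `v` for `(x', p)` near `(x, 0)`
(`IsCompact.eventually_forall_of_forall_eventually`); `2`-homogeneity removes the normalisation,
and `ε₁ := min (1/2) (min (c/2) (|μ| + C + 1)⁻¹)` turns `(μ, C, c/2)` into the (po3) shape. An
induction over the compact `S` (`IsCompact.induction_on`: the conclusion is monotone under
shrinking `δ` and `ε₁`) makes `δ, ε₁` uniform.
-/

noncomputable section

-- instance search through the nested operator types `E4 →L[ℝ] E4 →L[ℝ] E4 →L[ℝ] ℝ`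
set_option maxSynthPendingDepth 3

-- D-0017: single-problem summit, `Summit.<S>.<S>.…` by design (cf. lakefile `weak.linter.dupNamespace`).
set_option linter.dupNamespace false

namespace Summit.FinalStateConjecture.FinalStateConjecture.Theorems

open Set Filter
open Literature.Geometry.Lorentzian Literature.Geometry.Lorentzian.MetricCoord
open scoped Topology

/-- The (po3) conclusion is monotone under shrinking `ε₁` (the multiplier range and the penalty
grow, the demanded margin shrinks). [folklore] -/
private theorem multiplierFormStable_mono {f : E4 → ℝ} {x : E4} {G : E4 → E4 →L[ℝ] E4 →L[ℝ] ℝ}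
    {e' : E4} {ε₁ ε₁' : ℝ}
    (h : ∃ μ : ℝ, |μ| ≤ ε₁⁻¹ ∧ ∀ w : E4,
      ε₁ ^ 2 * ‖w‖ ^ 2 ≤ μ * G x w w - hessAt G f x w w
        + ε₁⁻¹ ^ 2 * ((G x e' w) ^ 2 + (fderiv ℝ f x w) ^ 2))
    (hε' : 0 < ε₁') (hle : ε₁' ≤ ε₁) :
    ∃ μ : ℝ, |μ| ≤ ε₁'⁻¹ ∧ ∀ w : E4,
      ε₁' ^ 2 * ‖w‖ ^ 2 ≤ μ * G x w w - hessAt G f x w w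
        + ε₁'⁻¹ ^ 2 * ((G x e' w) ^ 2 + (fderiv ℝ f x w) ^ 2) := by
  obtain ⟨μ, hμ, hall⟩ := h
  have hε : 0 < ε₁ := hε'.trans_le hle
  have hinv : ε₁⁻¹ ≤ ε₁'⁻¹ := by
    rw [inv_le_inv₀ hε hε']
    exact hle
  refine ⟨μ, hμ.trans hinv, fun w => ?_⟩
  have h1 : ε₁' ^ 2 * ‖w‖ ^ 2 ≤ ε₁ ^ 2 * ‖w‖ ^ 2 :=
    mul_le_mul_of_nonneg_right (pow_le_pow_left₀ hε'.le hle 2) (sq_nonneg _)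
  have h2 : ε₁⁻¹ ^ 2 * ((G x e' w) ^ 2 + (fderiv ℝ f x w) ^ 2) ≤
      ε₁'⁻¹ ^ 2 * ((G x e' w) ^ 2 + (fderiv ℝ f x w) ^ 2) :=
    mul_le_mul_of_nonneg_right (pow_le_pow_left₀ (inv_nonneg.2 hε.le) hinv 2) (by positivity)
  linarith [hall w]

/-- Pointwise multiplier form (F-1 + F-2) with a NONNEGATIVE penalty constant: a margin on the
doubly linearly constrained null cone gives `μ`, `C ≥ 0`, `c > 0` with
`q w w − μ g w w − C(ℓ₁ w² + ℓ₂ w²) ≤ −c‖w‖²` for all `w`. [folklore] -/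
private theorem multiplierFormStable_pointwise (q g : E4 →L[ℝ] E4 →L[ℝ] ℝ) (ℓ₁ ℓ₂ : E4 →L[ℝ] ℝ)
    (m : ℝ) (hm : 0 < m)
    (hq : ∀ w : E4, g w w = 0 → ℓ₁ w = 0 → ℓ₂ w = 0 → q w w ≤ -m * ‖w‖ ^ 2) :
    ∃ (μ C c : ℝ), 0 ≤ C ∧ 0 < c ∧
      ∀ w : E4, q w w - μ * g w w - C * ((ℓ₁ w) ^ 2 + (ℓ₂ w) ^ 2) ≤ -c * ‖w‖ ^ 2 := by
  obtain ⟨μ, C, c, hc, h⟩ :=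
    stub_conditionalMarginMultiplier stub_finslerLemma q g ℓ₁ ℓ₂ m hm hq
  refine ⟨μ, max C 0, c, le_max_right _ _, hc, fun w => ?_⟩
  have hpen : 0 ≤ (ℓ₁ w) ^ 2 + (ℓ₂ w) ^ 2 := by positivity
  have := h w
  nlinarith [le_max_left C 0, hpen]

/-- Homogeneity reduction: a degree-`2` homogeneous real function on `E4` that is nonpositive on
the unit sphere is nonpositive everywhere. [folklore] -/
private theorem multiplierFormStable_nonpos_of_sphere (Φ : E4 → ℝ)
    (hΦ : ∀ (r : ℝ) (x : E4), Φ (r • x) = r ^ 2 * Φ x)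
    (h : ∀ u ∈ Metric.sphere (0 : E4) 1, Φ u ≤ 0) : ∀ x : E4, Φ x ≤ 0 := by
  intro x
  by_cases hx : x = 0
  · have h0 := hΦ 0 0
    rw [zero_smul] at h0
    rw [hx, h0]
    simp
  · have hr : 0 < ‖x‖ := norm_pos_iff.2 hx
    have hu : ‖x‖⁻¹ • x ∈ Metric.sphere (0 : E4) 1 := by
      rw [mem_sphere_zero_iff_norm, norm_smul, norm_inv, norm_norm, inv_mul_cancel₀ hr.ne']
    have hxu : x = ‖x‖ • (‖x‖⁻¹ • x) := by
      rw [smul_smul, mul_inv_cancel₀ hr.ne', one_smul]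
    rw [hxu, hΦ]
    exact mul_nonpos_of_nonneg_of_nonpos (sq_nonneg _) (h _ hu)

/-- Continuity of the jet functional at an unperturbed point `((x, 0), v)` where `G₀` is `C¹`,
`f` is `C²` (on an open set around `x`) and `G₀ x` is invertible. [folklore] -/
private theorem multiplierFormStable_continuousAt
    {G₀ : E4 → E4 →L[ℝ] E4 →L[ℝ] ℝ} {f : E4 → ℝ} {e : E4} {U : Set E4} (μ C : ℝ) (hU : IsOpen U)
    (hG₀ : ContDiffOn ℝ 1 G₀ U) (hf : ContDiffOn ℝ 2 f U) {x : E4} (hx : x ∈ U)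
    (hi : (G₀ x).IsInvertible) (v : E4) :
    ContinuousAt (fun z : (E4 × (((E4 →L[ℝ] E4 →L[ℝ] ℝ) × (E4 →L[ℝ] E4 →L[ℝ] E4 →L[ℝ] ℝ)) × E4)) × E4 =>
      (fderiv ℝ (fderiv ℝ f) z.1.1 z.2 z.2 - fderiv ℝ f z.1.1 ((2⁻¹ : ℝ) •
        (G₀ z.1.1 + z.1.2.1.1).inverse (koszulOp (fderiv ℝ G₀ z.1.1 + z.1.2.1.2) z.2 z.2)))
      - μ * (G₀ z.1.1 + z.1.2.1.1) z.2 z.2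
      - C * ((fderiv ℝ f z.1.1 z.2) ^ 2 + ((G₀ z.1.1 + z.1.2.1.1) (e + z.1.2.2) z.2) ^ 2))
      (((x, 0), v) : (E4 × (((E4 →L[ℝ] E4 →L[ℝ] ℝ) × (E4 →L[ℝ] E4 →L[ℝ] E4 →L[ℝ] ℝ)) × E4)) × E4) := by
  have hxU : U ∈ 𝓝 x := hU.mem_nhds hx
  -- continuity of the jets of `G₀` and `f` at `x`
  have hcG : ContinuousAt G₀ x := hG₀.continuousOn.continuousAt hxU
  have hcdG : ContinuousAt (fderiv ℝ G₀) x :=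
    (hG₀.continuousOn_fderiv_of_isOpen hU le_rfl).continuousAt hxU
  have hcdf : ContinuousAt (fderiv ℝ f) x :=
    (hf.continuousOn_fderiv_of_isOpen hU (by norm_num)).continuousAt hxU
  have hcddf : ContinuousAt (fderiv ℝ (fderiv ℝ f)) x :=
    ((hf.fderiv_of_isOpen hU (m := 1) (by norm_num)).continuousOn_fderiv_of_isOpen hU
      le_rfl).continuousAt hxU
  -- the coordinate projections of the parameter space
  have h11 : Continuous fun z : (E4 × (((E4 →L[ℝ] E4 →L[ℝ] ℝ) × (E4 →L[ℝ] E4 →L[ℝ] E4 →L[ℝ] ℝ)) × E4)) × E4 => z.1.1 := continuous_fst.comp continuous_fst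
  have h2 : Continuous fun z : (E4 × (((E4 →L[ℝ] E4 →L[ℝ] ℝ) × (E4 →L[ℝ] E4 →L[ℝ] E4 →L[ℝ] ℝ)) × E4)) × E4 => z.2 := continuous_snd
  have h1211 : Continuous fun z : (E4 × (((E4 →L[ℝ] E4 →L[ℝ] ℝ) × (E4 →L[ℝ] E4 →L[ℝ] E4 →L[ℝ] ℝ)) × E4)) × E4 => z.1.2.1.1 :=
    continuous_fst.comp (continuous_fst.comp (continuous_snd.comp continuous_fst))
  have h1212 : Continuous fun z : (E4 × (((E4 →L[ℝ] E4 →L[ℝ] ℝ) × (E4 →L[ℝ] E4 →L[ℝ] E4 →L[ℝ] ℝ)) × E4)) × E4 => z.1.2.1.2 :=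
    continuous_snd.comp (continuous_fst.comp (continuous_snd.comp continuous_fst))
  have h122 : Continuous fun z : (E4 × (((E4 →L[ℝ] E4 →L[ℝ] ℝ) × (E4 →L[ℝ] E4 →L[ℝ] E4 →L[ℝ] ℝ)) × E4)) × E4 => z.1.2.2 :=
    continuous_snd.comp (continuous_snd.comp continuous_fst)
  -- continuity of the pieces at `z₀ = ((x, 0), v)`
  have hA : ContinuousAt (fun z : (E4 × (((E4 →L[ℝ] E4 →L[ℝ] ℝ) × (E4 →L[ℝ] E4 →L[ℝ] E4 →L[ℝ] ℝ)) × E4)) × E4 => G₀ z.1.1 + z.1.2.1.1) ((x, 0), v) :=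
    (hcG.comp h11.continuousAt).add h1211.continuousAt
  have hB : ContinuousAt (fun z : (E4 × (((E4 →L[ℝ] E4 →L[ℝ] ℝ) × (E4 →L[ℝ] E4 →L[ℝ] E4 →L[ℝ] ℝ)) × E4)) × E4 => fderiv ℝ f z.1.1) ((x, 0), v) :=
    hcdf.comp h11.continuousAt
  have hC : ContinuousAt (fun z : (E4 × (((E4 →L[ℝ] E4 →L[ℝ] ℝ) × (E4 →L[ℝ] E4 →L[ℝ] E4 →L[ℝ] ℝ)) × E4)) × E4 => fderiv ℝ (fderiv ℝ f) z.1.1 z.2 z.2)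
      ((x, 0), v) :=
    ((hcddf.comp h11.continuousAt).clm_apply h2.continuousAt).clm_apply h2.continuousAt
  have hD : ContinuousAt (fun z : (E4 × (((E4 →L[ℝ] E4 →L[ℝ] ℝ) × (E4 →L[ℝ] E4 →L[ℝ] E4 →L[ℝ] ℝ)) × E4)) × E4 => (G₀ z.1.1 + z.1.2.1.1).inverse)
      ((x, 0), v) := by
    refine ContinuousAt.comp_of_eq (hi.contDiffAt_map_inverse (n := 0)).continuousAt hA ?_
    simp
  have hE : ContinuousAt (fun z : (E4 × (((E4 →L[ℝ] E4 →L[ℝ] ℝ) × (E4 →L[ℝ] E4 →L[ℝ] E4 →L[ℝ] ℝ)) × E4)) × E4 =>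
      koszulOp (fderiv ℝ G₀ z.1.1 + z.1.2.1.2) z.2 z.2) ((x, 0), v) :=
    ((koszulOp.continuous.continuousAt.comp
      ((hcdG.comp h11.continuousAt).add h1212.continuousAt)).clm_apply
        h2.continuousAt).clm_apply h2.continuousAt
  have hHess : ContinuousAt (fun z : (E4 × (((E4 →L[ℝ] E4 →L[ℝ] ℝ) × (E4 →L[ℝ] E4 →L[ℝ] E4 →L[ℝ] ℝ)) × E4)) × E4 =>
      fderiv ℝ (fderiv ℝ f) z.1.1 z.2 z.2 - fderiv ℝ f z.1.1 ((2⁻¹ : ℝ) •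
        (G₀ z.1.1 + z.1.2.1.1).inverse (koszulOp (fderiv ℝ G₀ z.1.1 + z.1.2.1.2) z.2 z.2)))
      ((x, 0), v) :=
    hC.sub (hB.clm_apply ((hD.clm_apply hE).const_smul (2⁻¹ : ℝ)))
  have hQuad : ContinuousAt (fun z : (E4 × (((E4 →L[ℝ] E4 →L[ℝ] ℝ) × (E4 →L[ℝ] E4 →L[ℝ] E4 →L[ℝ] ℝ)) × E4)) × E4 => (G₀ z.1.1 + z.1.2.1.1) z.2 z.2)
      ((x, 0), v) :=
    (hA.clm_apply h2.continuousAt).clm_apply h2.continuousAt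
  have hL1 : ContinuousAt (fun z : (E4 × (((E4 →L[ℝ] E4 →L[ℝ] ℝ) × (E4 →L[ℝ] E4 →L[ℝ] E4 →L[ℝ] ℝ)) × E4)) × E4 => fderiv ℝ f z.1.1 z.2) ((x, 0), v) :=
    hB.clm_apply h2.continuousAt
  have hL2 : ContinuousAt (fun z : (E4 × (((E4 →L[ℝ] E4 →L[ℝ] ℝ) × (E4 →L[ℝ] E4 →L[ℝ] E4 →L[ℝ] ℝ)) × E4)) × E4 =>
      (G₀ z.1.1 + z.1.2.1.1) (e + z.1.2.2) z.2) ((x, 0), v) :=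
    (hA.clm_apply (continuousAt_const.add h122.continuousAt)).clm_apply h2.continuousAt
  exact (hHess.sub (continuousAt_const.mul hQuad)).sub
    (continuousAt_const.mul ((hL1.pow 2).add (hL2.pow 2)))

/-- The local step of (P-1): near every point `x ∈ U` (open, `G₀` is `C¹`, `f` is `C²`,
`G₀ x` invertible) at which the constrained margin holds, there are a neighbourhood `t` of `x`
and `δ, ε₁ > 0` such that the (po3) conclusion holds at every `x' ∈ t` for all `δ`-perturbed
jets and conditioning vectors. [folklore] -/
private theorem multiplierFormStable_local
    {G₀ : E4 → E4 →L[ℝ] E4 →L[ℝ] ℝ} {f : E4 → ℝ} {e : E4} {U : Set E4} {m : ℝ} (hU : IsOpen U)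
    (hG₀ : ContDiffOn ℝ 1 G₀ U) (hf : ContDiffOn ℝ 2 f U) (hm : 0 < m) {x : E4} (hx : x ∈ U)
    (hi : (G₀ x).IsInvertible)
    (hq : ∀ w : E4, G₀ x w w = 0 → fderiv ℝ f x w = 0 → G₀ x e w = 0 →
      hessAt G₀ f x w w ≤ -m * ‖w‖ ^ 2) :
    ∃ t ∈ 𝓝 x, ∃ (δ ε₁ : ℝ), 0 < δ ∧ 0 < ε₁ ∧ ∀ x' ∈ t,
      ∀ (G : E4 → E4 →L[ℝ] E4 →L[ℝ] ℝ) (e' : E4),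
        ‖G x' - G₀ x'‖ ≤ δ → ‖fderiv ℝ G x' - fderiv ℝ G₀ x'‖ ≤ δ → ‖e' - e‖ ≤ δ →
        ∃ μ : ℝ, |μ| ≤ ε₁⁻¹ ∧ ∀ w : E4,
          ε₁ ^ 2 * ‖w‖ ^ 2 ≤ μ * G x' w w - hessAt G f x' w w
            + ε₁⁻¹ ^ 2 * ((G x' e' w) ^ 2 + (fderiv ℝ f x' w) ^ 2) := by
  -- Step 1: pointwise multiplier form at `x` (F-1 + F-2)
  obtain ⟨μ, C, c, hC0, hc, hpt⟩ := multiplierFormStable_pointwise (hessAt G₀ f x) (G₀ x)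
    (fderiv ℝ f x) (G₀ x e) m hm hq
  -- the frozen-constant jet functional
  set F : (E4 × (((E4 →L[ℝ] E4 →L[ℝ] ℝ) × (E4 →L[ℝ] E4 →L[ℝ] E4 →L[ℝ] ℝ)) × E4)) × E4 → ℝ := (fun z : (E4 × (((E4 →L[ℝ] E4 →L[ℝ] ℝ) × (E4 →L[ℝ] E4 →L[ℝ] E4 →L[ℝ] ℝ)) × E4)) × E4 =>
      (fderiv ℝ (fderiv ℝ f) z.1.1 z.2 z.2 - fderiv ℝ f z.1.1 ((2⁻¹ : ℝ) •
        (G₀ z.1.1 + z.1.2.1.1).inverse (koszulOp (fderiv ℝ G₀ z.1.1 + z.1.2.1.2) z.2 z.2)))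
      - μ * (G₀ z.1.1 + z.1.2.1.1) z.2 z.2
      - C * ((fderiv ℝ f z.1.1 z.2) ^ 2 + ((G₀ z.1.1 + z.1.2.1.1) (e + z.1.2.2) z.2) ^ 2)) with hFdef
  -- Step 2: the frozen-constant jet functional is `< -c/2` on the unit sphere near `(x, 0)`
  have hsphere : ∀ v ∈ Metric.sphere (0 : E4) 1,
      ∀ᶠ z : (E4 × (((E4 →L[ℝ] E4 →L[ℝ] ℝ) × (E4 →L[ℝ] E4 →L[ℝ] E4 →L[ℝ] ℝ)) × E4)) × E4 in 𝓝 ((x, 0), v), F z < -(c / 2) := by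
    intro v hv
    have hv1 : ‖v‖ = 1 := mem_sphere_zero_iff_norm.1 hv
    have h0 : F ((x, 0), v) < -(c / 2) := by
      have h := hpt v
      rw [hv1, hessAt_apply, chrAt_apply] at h
      have hval : F ((x, 0), v) =
          fderiv ℝ (fderiv ℝ f) x v v - fderiv ℝ f x ((2⁻¹ : ℝ) •
            (G₀ x).inverse (koszulOp (fderiv ℝ G₀ x) v v)) - μ * G₀ x v v -
            C * ((fderiv ℝ f x v) ^ 2 + (G₀ x e v) ^ 2) := by
        simp [hFdef]
      rw [hval]
      have : fderiv ℝ (fderiv ℝ f) x v v - fderiv ℝ f x ((2⁻¹ : ℝ) •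
            (G₀ x).inverse (koszulOp (fderiv ℝ G₀ x) v v)) - μ * G₀ x v v -
            C * ((fderiv ℝ f x v) ^ 2 + (G₀ x e v) ^ 2) ≤ -c * 1 ^ 2 := h
      linarith
    have hcont : ContinuousAt F ((x, 0), v) := by
      rw [hFdef]
      exact multiplierFormStable_continuousAt μ C hU hG₀ hf hx hi v
    exact hcont.eventually_lt continuousAt_const h0
  have hnear : ∀ᶠ q : E4 × (((E4 →L[ℝ] E4 →L[ℝ] ℝ) × (E4 →L[ℝ] E4 →L[ℝ] E4 →L[ℝ] ℝ)) × E4) in 𝓝 (x, 0), ∀ v ∈ Metric.sphere (0 : E4) 1,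
      F (q, v) < -(c / 2) :=
    (isCompact_sphere (0 : E4) 1).eventually_forall_of_forall_eventually hsphere
  -- Step 3: a product neighbourhood `t ×ˢ ball 0 r`
  obtain ⟨t, ht, s, hs, hts⟩ := mem_nhds_prod_iff.1 hnear
  obtain ⟨r, hr, hrs⟩ := Metric.mem_nhds_iff.1 hs
  -- Step 4: the constants
  set ε₁ : ℝ := min (1 / 2) (min (c / 2) (|μ| + C + 1)⁻¹) with hε₁def
  have hK : 0 < |μ| + C + 1 := by positivity
  have hε₁pos : 0 < ε₁ := lt_min (by norm_num) (lt_min (half_pos hc) (inv_pos.2 hK))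
  have hε₁half : ε₁ ≤ 1 / 2 := min_le_left _ _
  have hε₁c : ε₁ ≤ c / 2 := (min_le_right _ _).trans (min_le_left _ _)
  have hε₁K : ε₁ ≤ (|μ| + C + 1)⁻¹ := (min_le_right _ _).trans (min_le_right _ _)
  have hinvK : |μ| + C + 1 ≤ ε₁⁻¹ := by
    rw [le_inv_comm₀ hK hε₁pos]
    exact hε₁K
  have hsq : ε₁ ^ 2 ≤ c / 2 := by nlinarith
  have hμb : |μ| ≤ ε₁⁻¹ := by linarith [abs_nonneg μ]
  have hCb : C ≤ ε₁⁻¹ ^ 2 := by nlinarith [abs_nonneg μ]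
  refine ⟨t, ht, r / 2, ε₁, half_pos hr, hε₁pos, fun x' hx' G e' hG hdG he => ?_⟩
  -- Step 5: at `x' ∈ t` with a `δ`-perturbed jet, the functional is `< -c/2` on the sphere
  set p : (((E4 →L[ℝ] E4 →L[ℝ] ℝ) × (E4 →L[ℝ] E4 →L[ℝ] E4 →L[ℝ] ℝ)) × E4) := ((G x' - G₀ x', fderiv ℝ G x' - fderiv ℝ G₀ x'), e' - e) with hpdef
  have hp : p ∈ s := by
    refine hrs (mem_ball_zero_iff.2 ?_)
    have h1 : ‖p‖ ≤ r / 2 := max_le (max_le hG hdG) he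
    linarith
  have hgood := hts (mk_mem_prod hx' hp)
  simp only [mem_setOf_eq] at hgood
  -- Step 6: homogeneity
  refine ⟨μ, hμb, fun w => ?_⟩
  have key := multiplierFormStable_nonpos_of_sphere
    (fun w => hessAt G f x' w w - μ * G x' w w
      - C * ((fderiv ℝ f x' w) ^ 2 + (G x' e' w) ^ 2) + c / 2 * ‖w‖ ^ 2) ?_ ?_ w
  · have hpen : 0 ≤ (G x' e' w) ^ 2 + (fderiv ℝ f x' w) ^ 2 := by positivity
    have h1 : C * ((fderiv ℝ f x' w) ^ 2 + (G x' e' w) ^ 2) ≤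
        ε₁⁻¹ ^ 2 * ((G x' e' w) ^ 2 + (fderiv ℝ f x' w) ^ 2) := by
      rw [add_comm ((fderiv ℝ f x' w) ^ 2)]
      exact mul_le_mul_of_nonneg_right hCb hpen
    have h2 : ε₁ ^ 2 * ‖w‖ ^ 2 ≤ c / 2 * ‖w‖ ^ 2 :=
      mul_le_mul_of_nonneg_right hsq (sq_nonneg _)
    linarith
  · intro ρ y
    simp only [map_smul, smul_apply, smul_eq_mul, norm_smul, Real.norm_eq_abs, mul_pow, sq_abs]
    ring
  · intro u hu
    have h := hgood u hu
    have hu1 : ‖u‖ = 1 := mem_sphere_zero_iff_norm.1 hu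
    have hval : F ((x', p), u) =
        hessAt G f x' u u - μ * G x' u u - C * ((fderiv ℝ f x' u) ^ 2 + (G x' e' u) ^ 2) := by
      rw [hessAt_apply, chrAt_apply]
      simp only [hFdef, hpdef, add_sub_cancel]
      rfl
    rw [hval] at h
    simp only [hu1]
    linarith

/-- **Stub (P-1) of the line `photon-shell-pseudoconvexity` (crux `GapExhaustion`,
stmt-FinalStateConjecture-10808) — the uniform, `C¹`-stable multiplier form (Ionescu–Klainerman,
Invent. Math. 175 (2009), Definition 3.1, condition (po3)) of a constrained Hessian margin.**
Let `G₀` be `C¹` and `f` be `C²` on an open neighbourhood of the compact set `S ⊆ E4`, with `G₀ x`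
invertible on `S`, and suppose `hessAt G₀ f x w w ≤ −m‖w‖²` (`m > 0`) for all `x ∈ S` and all
`w` with `G₀ x w w = 0`, `df_x(w) = 0`, `G₀ x e w = 0` (`e` a fixed conditioning vector — (HoCond2)
with `T = e`). Then there are `δ, ε₁ > 0` such that for every `x ∈ S`, every field of components
`G` with `‖G x − G₀ x‖ ≤ δ`, `‖DG(x) − DG₀(x)‖ ≤ δ` and every `e'` with `‖e' − e‖ ≤ δ` there is a
multiplier `μ ∈ [−ε₁⁻¹, ε₁⁻¹]` with
`ε₁²‖w‖² ≤ μ G x w w − hessAt G f x w w + ε₁⁻²((G x e' w)² + (df_x w)²)` for ALL `w : E4` —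
literally (po3) with `V = e'`, `h = f`, `ε = ε₁` (smaller `ε` only enlarges the penalty).
Pointwise from Finsler's lemma (F-1) and its doubly constrained form (F-2); uniform and stable
by continuity of the frozen-constant jet functional, compactness of the unit sphere and of `S`,
and `2`-homogeneity. [folklore] -/
theorem stub_multiplierFormStable :
    ∀ (G₀ : E4 → E4 →L[ℝ] E4 →L[ℝ] ℝ) (f : E4 → ℝ) (e : E4) (S : Set E4) (m : ℝ),
      IsCompact S → 0 < m →
      (∃ U : Set E4, IsOpen U ∧ S ⊆ U ∧ ContDiffOn ℝ 1 G₀ U ∧ ContDiffOn ℝ 2 f U) →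
      (∀ x ∈ S, (G₀ x).IsInvertible) →
      (∀ x ∈ S, ∀ w : E4, G₀ x w w = 0 → fderiv ℝ f x w = 0 → G₀ x e w = 0 →
        hessAt G₀ f x w w ≤ -m * ‖w‖ ^ 2) →
      ∃ (δ ε₁ : ℝ), 0 < δ ∧ 0 < ε₁ ∧ ∀ x ∈ S, ∀ (G : E4 → E4 →L[ℝ] E4 →L[ℝ] ℝ) (e' : E4),
        ‖G x - G₀ x‖ ≤ δ → ‖fderiv ℝ G x - fderiv ℝ G₀ x‖ ≤ δ → ‖e' - e‖ ≤ δ →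
        ∃ μ : ℝ, |μ| ≤ ε₁⁻¹ ∧ ∀ w : E4,
          ε₁ ^ 2 * ‖w‖ ^ 2 ≤ μ * G x w w - hessAt G f x w w
            + ε₁⁻¹ ^ 2 * ((G x e' w) ^ 2 + (fderiv ℝ f x w) ^ 2) := by
  intro G₀ f e S m hS hm hU hinv hmargin
  obtain ⟨U, hU, hSU, hG₀, hf⟩ := hU
  -- induction over the compact `S`
  refine hS.induction_on (p := fun A => ∃ (δ ε₁ : ℝ), 0 < δ ∧ 0 < ε₁ ∧ ∀ x ∈ A,
      ∀ (G : E4 → E4 →L[ℝ] E4 →L[ℝ] ℝ) (e' : E4),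
        ‖G x - G₀ x‖ ≤ δ → ‖fderiv ℝ G x - fderiv ℝ G₀ x‖ ≤ δ → ‖e' - e‖ ≤ δ →
        ∃ μ : ℝ, |μ| ≤ ε₁⁻¹ ∧ ∀ w : E4,
          ε₁ ^ 2 * ‖w‖ ^ 2 ≤ μ * G x w w - hessAt G f x w w
            + ε₁⁻¹ ^ 2 * ((G x e' w) ^ 2 + (fderiv ℝ f x w) ^ 2)) ?_ ?_ ?_ ?_
  · exact ⟨1, 1, one_pos, one_pos, fun x hx => (notMem_empty x hx).elim⟩
  · rintro A B hAB ⟨δ, ε₁, hδ, hε₁, h⟩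
    exact ⟨δ, ε₁, hδ, hε₁, fun x hx => h x (hAB hx)⟩
  · rintro A B ⟨δ₁, ε₁, hδ₁, hε₁, h₁⟩ ⟨δ₂, ε₂, hδ₂, hε₂, h₂⟩
    refine ⟨min δ₁ δ₂, min ε₁ ε₂, lt_min hδ₁ hδ₂, lt_min hε₁ hε₂, fun x hx G e' hG hdG he => ?_⟩
    rcases hx with hx | hx
    · exact multiplierFormStable_mono (h₁ x hx G e' (hG.trans (min_le_left _ _))
        (hdG.trans (min_le_left _ _)) (he.trans (min_le_left _ _))) (lt_min hε₁ hε₂)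
        (min_le_left _ _)
    · exact multiplierFormStable_mono (h₂ x hx G e' (hG.trans (min_le_right _ _))
        (hdG.trans (min_le_right _ _)) (he.trans (min_le_right _ _))) (lt_min hε₁ hε₂)
        (min_le_right _ _)
  · intro x hx
    obtain ⟨t, ht, δ, ε₁, hδ, hε₁, h⟩ := multiplierFormStable_local hU hG₀ hf hm (hSU hx)
      (hinv x hx) (hmargin x hx)
    exact ⟨t, mem_nhdsWithin_of_mem_nhds ht, δ, ε₁, hδ, hε₁, h⟩

end Summit.FinalStateConjecture.FinalStateConjecture.Theorems

end
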